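import Literature.Geometry.Kaehler.HolomorphicChainAddProofs
import HarnessLib

/-!
# Additivity of the current of a holomorphic chain, II: the assembly modulo null intersections

Second step of the proof of the named fact `Literature.Geometry.Kaehler.Chirka1989_toCurrent_add`
(`[T + T'] = [T] + [T']`, [Chirka1989, §16.1, p. 206]) for the single-carrier encoding
`HolomorphicChain.toCurrent T = currentOfIntegration (reg |T|) θ_T ξ_T` of
`Literature/Geometry/Kaehler/HolomorphicChain.lean`.  The main result
`HolomorphicChain.toCurrent_add_of_null_inter` proves additivity for two chains `T, T'` on
`Ω ⊆ V` from three inputs, all consequences of Lelong's theorem [Chirka1989, §14.1] and of the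
dimension theory of analytic sets, which are NOT proved here and enter as explicit hypotheses:

1. the carriers `reg |T|`, `reg |T'|`, `reg |T + T'|` are measurable;
2. the three integrands `θ • ξ₁ ∧ ⋯ ∧ ξ_{2p}` are locally `𝓗^{2p} ⌞ carrier`-integrable on `Ω` (so that
   the three currents of integration are honest integrals, not the junk value `0`);
3. two DISTINCT components of `T` or `T'` meet in an `𝓗^{2p}`-null set.

(1)–(2) are conjuncts of the named fact `Harvey1977_isRectifiableData_toCurrent`; (3) is
[Chirka1989, §3.7 Cor.] applied to `Aᵢ ∩ Aⱼ`, of dimension `< p` [Chirka1989, §5.3].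

The proof: outside the null set `⋃_{Aᵢ ≠ Aⱼ} Aᵢ ∩ Aⱼ` a point `y` lies on at most one component
`A` of `T` or `T'`; on a neighbourhood `U` of `y` meeting no other component
(`exists_isOpen_forall_mem_of_locallyFinite`, local finiteness) each of `|T|, |T'|, |T + T'|` is either
`A ∩ U` or empty, so the three carriers agree near `y` whenever they contain `y`, the three
orientation frames at `y` coincide (`HolomorphicChain.orientationFrame_eq_of_support_inter_eq`), the
densities are `mult_T A`, `mult_{T'} A`, `mult_T A + mult_{T'} A`, and the integrands add up
pointwise (`HolomorphicChain.indicator_integrand_add`).  Then the three integrals are rewritten over the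
union of the carriers and compared almost everywhere.

No named facts, no definitions.

## References

* E. M. Chirka, *Complex Analytic Sets*, Kluwer 1989, §3.7, §5.3, §14.1, §16.1 (p. 206) [Chirka1989].
-/

open scoped Manifold Topology ENNReal
open Set Filter MeasureTheory

namespace Literature.Geometry.Kaehler

open Literature.Geometry.GeometricMeasureTheory

-- Nested operator-norm instances on `Covector V m`, as in `Currents.lean`.
set_option maxSynthPendingDepth 2

/-! ### Local finiteness: a neighbourhood meeting only the members through the point -/

/-- For a locally finite family of closed sets (given by a predicate `P`) in a locally compact space,
every point `y` has an open neighbourhood which meets only those members of the family that pass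
through `y`. [folklore] -/
theorem exists_isOpen_forall_mem_of_locallyFinite {X : Type*} [TopologicalSpace X]
    [LocallyCompactSpace X] {P : Set X → Prop}
    (hfin : ∀ ⦃K : Set X⦄, IsCompact K → {Z : Set X | P Z ∧ (K ∩ Z).Nonempty}.Finite)
    (hcl : ∀ Z, P Z → IsClosed Z) (y : X) :
    ∃ U : Set X, IsOpen U ∧ y ∈ U ∧ ∀ Z, P Z → (Z ∩ U).Nonempty → y ∈ Z := by
  obtain ⟨K, hK, hKy⟩ := exists_compact_mem_nhds y
  have hF : {Z : Set X | (P Z ∧ (K ∩ Z).Nonempty) ∧ y ∉ Z}.Finite := (hfin hK).subset (sep_subset _ _)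
  set B : Set X := ⋃ Z ∈ {Z : Set X | (P Z ∧ (K ∩ Z).Nonempty) ∧ y ∉ Z}, Z with hB
  have hBcl : IsClosed B := hF.isClosed_biUnion fun Z hZ => hcl Z hZ.1.1
  have hyB : y ∉ B := by
    rw [hB, mem_iUnion₂]
    rintro ⟨Z, hZ, hyZ⟩
    exact hZ.2 hyZ
  refine ⟨interior K \ B, isOpen_interior.sdiff hBcl, ⟨mem_interior_iff_mem_nhds.2 hKy, hyB⟩, ?_⟩
  rintro Z hPZ ⟨z, hzZ, hzK, hzB⟩
  by_contra hyZ
  exact hzB (mem_iUnion₂.2 ⟨Z, ⟨⟨hPZ, z, interior_subset hzK, hzZ⟩, hyZ⟩, hzZ⟩)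

namespace HolomorphicChain

section General

variable {E : Type*} [NormedAddCommGroup E] [NormedSpace ℂ E]
  {H : Type*} [TopologicalSpace H] {I : ModelWithCorners ℂ E H}
  {M : Type*} [TopologicalSpace M] [ChartedSpace H M] {p : ℕ}

/-- A holomorphic chain on a σ-compact manifold has countably many components (finitely many
meet each member of a compact exhaustion, and components are nonempty). [cite: Chirka1989, §11.5, p. 130] -/
theorem countable_components [SigmaCompactSpace M] (T : HolomorphicChain I M p) :
    T.components.Countable := by
  have h : T.components ⊆
      ⋃ n : ℕ, {Z : Set M | T.mult Z ≠ 0 ∧ (compactCovering M n ∩ Z).Nonempty} := by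
    intro Z hZ
    obtain ⟨z, hz⟩ := (T.hasPureDim_of_mult_ne_zero hZ).nonempty
    obtain ⟨n, hn⟩ : ∃ n, z ∈ compactCovering M n :=
      mem_iUnion.1 (by rw [iUnion_compactCovering]; exact mem_univ z)
    exact mem_iUnion.2 ⟨n, hZ, z, hn, hz⟩
  exact (countable_iUnion fun n =>
    (T.finite_inter_compact (isCompact_compactCovering M n)).countable).mono h

/-- Given two chains `T, T'` on a locally compact `M`, every point `y` has an open neighbourhood
meeting only those components of `T` or of `T'` which pass through `y`.
[cite: Chirka1989, §11.5 Def., p. 130] -/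
theorem exists_isOpen_forall_mem₂ [LocallyCompactSpace M] (T T' : HolomorphicChain I M p) (y : M) :
    ∃ U : Set M, IsOpen U ∧ y ∈ U ∧
      ∀ Z, (T.mult Z ≠ 0 ∨ T'.mult Z ≠ 0) → (Z ∩ U).Nonempty → y ∈ Z := by
  refine exists_isOpen_forall_mem_of_locallyFinite (P := fun Z => T.mult Z ≠ 0 ∨ T'.mult Z ≠ 0)
    (fun K hK => ?_) (fun Z hZ => ?_) y
  · refine ((T.finite_inter_compact hK).union (T'.finite_inter_compact hK)).subset ?_
    rintro Z ⟨hZ | hZ, hKZ⟩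
    · exact Or.inl ⟨hZ, hKZ⟩
    · exact Or.inr ⟨hZ, hKZ⟩
  · rcases hZ with hZ | hZ
    · exact (T.isIrreducibleAnalyticSet_of_mult_ne_zero hZ).1.isClosed
    · exact (T'.isIrreducibleAnalyticSet_of_mult_ne_zero hZ).1.isClosed

/-- Two sets with the same trace on an open neighbourhood of `x` have the same regular locus at
`x`. [folklore] -/
theorem _root_.Literature.Geometry.Kaehler.mem_regularLocus_congr_set {Z Z' W : Set M} {x : M}
    (hW : IsOpen W) (hx : x ∈ W) (h : Z ∩ W = Z' ∩ W) :
    x ∈ regularLocus I Z ↔ x ∈ regularLocus I Z' := by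
  have hmem : x ∈ Z ↔ x ∈ Z' :=
    ⟨fun hz => (h.subset ⟨hz, hx⟩).1, fun hz => (h.symm.subset ⟨hz, hx⟩).1⟩
  constructor
  · rintro ⟨hxZ, c, hc⟩
    exact ⟨hmem.1 hxZ, c, hc.congr_set hW hx h⟩
  · rintro ⟨hxZ, c, hc⟩
    exact ⟨hmem.2 hxZ, c, hc.congr_set hW hx h.symm⟩

end General

section Pointwise

variable {V : Type*} [NormedAddCommGroup V] [InnerProductSpace ℂ V] {Ω : TopologicalSpace.Opens V}
  {p : ℕ}

/-- Membership of (the image of) a point of `Ω` in the carrier `reg |T|`. [folklore] -/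
theorem coe_mem_carrier_iff (T : HolomorphicChain 𝓘(ℂ, V) Ω p) (y : Ω) :
    (y : V) ∈ T.carrier ↔ y ∈ regularLocus 𝓘(ℂ, V) T.support := by
  constructor
  · rintro ⟨y', hy', hyy'⟩
    obtain rfl : y' = y := Subtype.ext hyy'
    exact hy'
  · exact fun hy => ⟨y, hy, rfl⟩

/-- A point of the carrier of `T` lies on some component of `T`. [folklore] -/
theorem exists_mult_ne_zero_of_coe_mem_carrier (T : HolomorphicChain 𝓘(ℂ, V) Ω p) {y : Ω}
    (hy : (y : V) ∈ T.carrier) : ∃ Z, T.mult Z ≠ 0 ∧ y ∈ Z :=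
  mem_support_iff.1 (regularLocus_subset _ ((T.coe_mem_carrier_iff y).1 hy))

variable [MeasurableSpace V] [BorelSpace V]

/-- **Pointwise additivity of the integrands at a generic point.** Let `y ∈ Ω` lie on at most one
component of `T` or `T'`, and let `U ∋ y` be an open set meeting only components through `y`.
Then, for every `2p`-covector `φ`, the integrands `1_{reg |S|} θ_S φ(ξ_S)` of the currents `[S]`,
`S ∈ {T, T', T + T'}`, satisfy at `y` the identity "`(T + T')`-term = `T`-term + `T'`-term": near `y`
all three supports containing `y` are the same set `A ∩ U`, so the three frames at `y` coincide and
the densities `mult_S A` add up.  Here `φ` is any covector field (in the application, a test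
form). [cite: Chirka1989, §16.1, p. 206] -/
theorem indicator_integrand_add (T T' : HolomorphicChain 𝓘(ℂ, V) Ω p) {y : Ω}
    (hy : ∀ Z Z', (T.mult Z ≠ 0 ∨ T'.mult Z ≠ 0) → (T.mult Z' ≠ 0 ∨ T'.mult Z' ≠ 0) →
      y ∈ Z → y ∈ Z' → Z = Z')
    {U : Set Ω} (hU : IsOpen U) (hyU : y ∈ U)
    (hUZ : ∀ Z, (T.mult Z ≠ 0 ∨ T'.mult Z ≠ 0) → (Z ∩ U).Nonempty → y ∈ Z)
    (φ : V → Covector V (2 * p)) :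
    (T + T').carrier.indicator
        (fun x => (((T + T').density x : ℤ) : ℝ) * φ x ((T + T').orientationFrame x)) y =
      T.carrier.indicator (fun x => ((T.density x : ℤ) : ℝ) * φ x (T.orientationFrame x)) y +
      T'.carrier.indicator (fun x => ((T'.density x : ℤ) : ℝ) * φ x (T'.orientationFrame x)) y := by
  classical
  -- the chains whose components are components of `T` or of `T'`
  have hT : ∀ Z, T.mult Z ≠ 0 → T.mult Z ≠ 0 ∨ T'.mult Z ≠ 0 := fun Z h => Or.inl h
  have hT' : ∀ Z, T'.mult Z ≠ 0 → T.mult Z ≠ 0 ∨ T'.mult Z ≠ 0 := fun Z h => Or.inr h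
  have hTT' : ∀ Z, (T + T').mult Z ≠ 0 → T.mult Z ≠ 0 ∨ T'.mult Z ≠ 0 := by
    intro Z h
    by_contra h'
    push Not at h'
    exact h (by simp [h'.1, h'.2])
  by_cases hex : ∃ Z, (T.mult Z ≠ 0 ∨ T'.mult Z ≠ 0) ∧ y ∈ Z
  · obtain ⟨A, hA, hyA⟩ := hex
    have huniq : ∀ Z, (T.mult Z ≠ 0 ∨ T'.mult Z ≠ 0) → y ∈ Z → Z = A :=
      fun Z hZ hyZ => hy Z A hZ hA hyZ hyA
    -- densities at `y`
    have hθ : ∀ S : HolomorphicChain 𝓘(ℂ, V) Ω p,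
        (∀ Z, S.mult Z ≠ 0 → T.mult Z ≠ 0 ∨ T'.mult Z ≠ 0) → S.density y = S.mult A := by
      intro S hS
      rw [density_apply_coe]
      exact multAt_eq_mult hyA fun Z hZ hyZ => huniq Z (hS Z hZ) hyZ
    -- supports near `y`
    have hsupp : ∀ S : HolomorphicChain 𝓘(ℂ, V) Ω p,
        (∀ Z, S.mult Z ≠ 0 → T.mult Z ≠ 0 ∨ T'.mult Z ≠ 0) → S.mult A ≠ 0 →
          S.support ∩ U = A ∩ U := by
      intro S hS hSA
      ext z
      constructor
      · rintro ⟨hz, hzU⟩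
        obtain ⟨Z, hZ, hzZ⟩ := mem_support_iff.1 hz
        obtain rfl : Z = A := huniq Z (hS Z hZ) (hUZ Z (hS Z hZ) ⟨z, hzZ, hzU⟩)
        exact ⟨hzZ, hzU⟩
      · rintro ⟨hz, hzU⟩
        exact ⟨subset_support hSA hz, hzU⟩
    -- carriers at `y`
    have hcar : ∀ S : HolomorphicChain 𝓘(ℂ, V) Ω p,
        (∀ Z, S.mult Z ≠ 0 → T.mult Z ≠ 0 ∨ T'.mult Z ≠ 0) →
          ((y : V) ∈ S.carrier ↔ S.mult A ≠ 0 ∧ y ∈ regularLocus 𝓘(ℂ, V) A) := by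
      intro S hS
      constructor
      · intro h
        obtain ⟨Z, hZ, hyZ⟩ := S.exists_mult_ne_zero_of_coe_mem_carrier h
        obtain rfl : Z = A := huniq Z (hS Z hZ) hyZ
        exact ⟨hZ, (mem_regularLocus_congr_set hU hyU (hsupp S hS hZ)).1
          ((S.coe_mem_carrier_iff y).1 h)⟩
      · rintro ⟨hSA, hreg⟩
        exact (S.coe_mem_carrier_iff y).2
          ((mem_regularLocus_congr_set hU hyU (hsupp S hS hSA)).2 hreg)
    -- a common frame at `y`
    obtain ⟨e, he⟩ : ∃ e : Fin (2 * p) → V, ∀ S : HolomorphicChain 𝓘(ℂ, V) Ω p,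
        (∀ Z, S.mult Z ≠ 0 → T.mult Z ≠ 0 ∨ T'.mult Z ≠ 0) → S.mult A ≠ 0 →
          S.orientationFrame y = e := by
      have main : ∀ S₀ : HolomorphicChain 𝓘(ℂ, V) Ω p,
          (∀ Z, S₀.mult Z ≠ 0 → T.mult Z ≠ 0 ∨ T'.mult Z ≠ 0) → S₀.mult A ≠ 0 →
          ∃ e : Fin (2 * p) → V, ∀ S : HolomorphicChain 𝓘(ℂ, V) Ω p,
            (∀ Z, S.mult Z ≠ 0 → T.mult Z ≠ 0 ∨ T'.mult Z ≠ 0) → S.mult A ≠ 0 →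
              S.orientationFrame y = e := by
        intro S₀ hS₀ hS₀A
        refine ⟨S₀.orientationFrame y, fun S hS hSA => ?_⟩
        exact S.orientationFrame_eq_of_support_inter_eq S₀ hU
          (by rw [hsupp S hS hSA, hsupp S₀ hS₀ hS₀A]) hyU
      rcases hA with hA | hA
      · exact main T hT hA
      · exact main T' hT' hA
    -- each of the three terms
    have hterm : ∀ S : HolomorphicChain 𝓘(ℂ, V) Ω p,
        (∀ Z, S.mult Z ≠ 0 → T.mult Z ≠ 0 ∨ T'.mult Z ≠ 0) →
        S.carrier.indicator (fun x => ((S.density x : ℤ) : ℝ) * φ x (S.orientationFrame x)) y =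
          if y ∈ regularLocus 𝓘(ℂ, V) A then ((S.mult A : ℤ) : ℝ) * φ y e else 0 := by
      intro S hS
      by_cases hSA : S.mult A = 0
      · have hyS : (y : V) ∉ S.carrier := fun h => ((hcar S hS).1 h).1 hSA
        rw [indicator_of_notMem hyS, hSA, Int.cast_zero, zero_mul, ite_self]
      · by_cases hreg : y ∈ regularLocus 𝓘(ℂ, V) A
        · rw [indicator_of_mem ((hcar S hS).2 ⟨hSA, hreg⟩), if_pos hreg, hθ S hS, he S hS hSA]
        · have hyS : (y : V) ∉ S.carrier := fun h => hreg ((hcar S hS).1 h).2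
          rw [indicator_of_notMem hyS, if_neg hreg]
    rw [hterm (T + T') hTT', hterm T hT, hterm T' hT']
    split_ifs
    · rw [mult_add, Pi.add_apply, Int.cast_add, add_mul]
    · rw [add_zero]
  · -- no component through `y`: all three terms vanish
    push Not at hex
    have hout : ∀ S : HolomorphicChain 𝓘(ℂ, V) Ω p,
        (∀ Z, S.mult Z ≠ 0 → T.mult Z ≠ 0 ∨ T'.mult Z ≠ 0) → (y : V) ∉ S.carrier := by
      intro S hS h
      obtain ⟨Z, hZ, hyZ⟩ := S.exists_mult_ne_zero_of_coe_mem_carrier h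
      exact hex Z (hS Z hZ) hyZ
    rw [indicator_of_notMem (hout _ hTT'), indicator_of_notMem (hout _ hT),
      indicator_of_notMem (hout _ hT'), add_zero]

end Pointwise

/-! ### The assembly -/

section Assembly

variable {V : Type*} [NormedAddCommGroup V] [InnerProductSpace ℂ V]
  [MeasurableSpace V] [BorelSpace V] {Ω : TopologicalSpace.Opens V} {p : ℕ}

/-- The integrand of `[T]` against a test form is integrable on the carrier when the density field
is locally integrable (Mathlib's `TestFunction.integrable_bilin`). [cite: Federer1969, 4.1.7] -/
theorem integrableOn_integrand (T : HolomorphicChain 𝓘(ℂ, V) Ω p)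
    (hint : LocallyIntegrableOn (fun x => (T.density x : ℝ) • frameVector (T.orientationFrame x))
      (Ω : Set V) ((μHE[2 * p] : Measure V).restrict T.carrier))
    (φ : TestForm Ω (2 * p)) :
    IntegrableOn (fun x => ((T.density x : ℤ) : ℝ) * φ x (T.orientationFrame x)) T.carrier
      (μHE[2 * p] : Measure V) := by
  have h := TestFunction.integrable_bilin (covectorPairing V (2 * p)) hint φ
  simp only [covectorPairing_apply, smul_apply, frameVector_apply, smul_eq_mul] at h
  exact h

/-- **`[T + T'] = [T] + [T']`, modulo Lelong's theorem and null intersections.** For two holomorphic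
`p`-chains `T, T'` on `Ω ⊆ V` such that the carriers `reg |T|`, `reg |T'|`, `reg |T + T'|` are
measurable, the three density fields `θ • ξ₁ ∧ ⋯ ∧ ξ_{2p}` are locally `𝓗^{2p} ⌞ carrier`-integrable
on `Ω` (both follow from Lelong's theorem, and are conjuncts of
`Harvey1977_isRectifiableData_toCurrent`), and any two distinct components of `T` or `T'` meet in an
`𝓗^{2p}`-null set (dimension theory), the current of the sum is the sum of the currents.
[cite: Chirka1989, §16.1, p. 206] -/
theorem toCurrent_add_of_null_inter [FiniteDimensional ℂ V] (T T' : HolomorphicChain 𝓘(ℂ, V) Ω p)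
    (hm : MeasurableSet T.carrier) (hm' : MeasurableSet T'.carrier)
    (hm₂ : MeasurableSet (T + T').carrier)
    (hint : LocallyIntegrableOn (fun x => (T.density x : ℝ) • frameVector (T.orientationFrame x))
      (Ω : Set V) ((μHE[2 * p] : Measure V).restrict T.carrier))
    (hint' : LocallyIntegrableOn (fun x => (T'.density x : ℝ) • frameVector (T'.orientationFrame x))
      (Ω : Set V) ((μHE[2 * p] : Measure V).restrict T'.carrier))
    (hint₂ : LocallyIntegrableOn
      (fun x => ((T + T').density x : ℝ) • frameVector ((T + T').orientationFrame x))
      (Ω : Set V) ((μHE[2 * p] : Measure V).restrict (T + T').carrier))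
    (hnull : ∀ Z Z' : Set Ω, Z ≠ Z' → (T.mult Z ≠ 0 ∨ T'.mult Z ≠ 0) →
      (T.mult Z' ≠ 0 ∨ T'.mult Z' ≠ 0) →
        (μHE[2 * p] : Measure V) ((↑) '' (Z ∩ Z') : Set V) = 0) :
    (T + T').toCurrent = T.toCurrent + T'.toCurrent := by
  classical
  haveI : LocallyCompactSpace Ω := Ω.2.locallyCompactSpace
  set μ : Measure V := μHE[2 * p] with hμ
  -- the union of the three carriers
  set S : Set V := T.carrier ∪ T'.carrier ∪ (T + T').carrier with hS
  have hSm : MeasurableSet S := (hm.union hm').union hm₂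
  -- the bad set: pairwise intersections of distinct components of `T` or `T'`
  set D : Set (Set Ω) := T.components ∪ T'.components with hD
  have hDc : D.Countable := T.countable_components.union T'.countable_components
  set B : Set V := ⋃ Z ∈ D, ⋃ Z' ∈ D, if Z = Z' then ∅ else ((↑) '' (Z ∩ Z') : Set V) with hB
  have hB0 : μ B = 0 := by
    rw [hB, measure_biUnion_null_iff hDc]
    intro Z hZ
    rw [measure_biUnion_null_iff hDc]
    intro Z' hZ'
    split_ifs with hZZ'
    · exact measure_empty
    · exact hnull Z Z' hZZ' hZ hZ'
  -- rewrite the three currents as integrals over `S`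
  have key : ∀ R : HolomorphicChain 𝓘(ℂ, V) Ω p, MeasurableSet R.carrier → R.carrier ⊆ S →
      LocallyIntegrableOn (fun x => (R.density x : ℝ) • frameVector (R.orientationFrame x))
        (Ω : Set V) (μ.restrict R.carrier) → ∀ φ : TestForm Ω (2 * p),
      R.toCurrent φ = ∫ x in S, R.carrier.indicator
        (fun x => ((R.density x : ℤ) : ℝ) * φ x (R.orientationFrame x)) x ∂μ := by
    intro R hR hRS hRint φ
    rw [toCurrent_def, currentOfIntegration, vectorCurrent_apply hRint, setIntegral_indicator hR,
      inter_eq_right.2 hRS]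
    simp only [smul_apply, frameVector_apply, smul_eq_mul]
  ext φ
  rw [add_apply, key (T + T') hm₂ subset_union_right hint₂ φ,
    key T hm (subset_union_left.trans subset_union_left) hint φ,
    key T' hm' (subset_union_right.trans subset_union_left) hint' φ,
    ← integral_add ((T.integrableOn_integrand hint φ).integrable_indicator hm).integrableOn
      ((T'.integrableOn_integrand hint' φ).integrable_indicator hm').integrableOn]
  refine integral_congr_ae ?_
  filter_upwards [ae_restrict_mem hSm, ae_restrict_of_ae (measure_eq_zero_iff_ae_notMem.1 hB0)]
    with x hxS hxB
  -- `x` is (the image of) a point `y ∈ Ω`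
  obtain ⟨y, rfl⟩ : ∃ y : Ω, (y : V) = x := by
    have hxΩ : x ∈ (Ω : Set V) := by
      rcases hxS with (hx | hx) | hx
      · exact T.carrier_subset hx
      · exact T'.carrier_subset hx
      · exact (T + T').carrier_subset hx
    exact ⟨⟨x, hxΩ⟩, rfl⟩
  -- `y` lies on at most one component of `T` or `T'`
  have hy : ∀ Z Z', (T.mult Z ≠ 0 ∨ T'.mult Z ≠ 0) → (T.mult Z' ≠ 0 ∨ T'.mult Z' ≠ 0) →
      y ∈ Z → y ∈ Z' → Z = Z' := by
    intro Z Z' hZ hZ' hyZ hyZ'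
    by_contra hne
    refine hxB (mem_iUnion₂.2 ⟨Z, hZ, mem_iUnion₂.2 ⟨Z', hZ', ?_⟩⟩)
    rw [if_neg hne]
    exact ⟨y, ⟨hyZ, hyZ'⟩, rfl⟩
  obtain ⟨U, hU, hyU, hUZ⟩ := T.exists_isOpen_forall_mem₂ T' y
  exact T.indicator_integrand_add T' hy hU hyU hUZ ⇑φ

end Assembly

/-! ### The assembly from Harvey's structure fact -/

section Harvey

universe u

variable {V : Type u} [NormedAddCommGroup V] [InnerProductSpace ℂ V] [FiniteDimensional ℂ V]
  [MeasurableSpace V] [BorelSpace V] {Ω : TopologicalSpace.Opens V} {p : ℕ}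

/-- **`[T + T'] = [T] + [T']` from `Harvey1977_isRectifiableData_toCurrent` and null intersections.**
The measurability of the carriers and the local integrability of the density fields required by
`HolomorphicChain.toCurrent_add_of_null_inter` are conjuncts of Harvey's structure fact
([Harvey1977, §2.1 (2.2)], which contains Lelong's theorem); what remains is the `𝓗^{2p}`-nullity of
the pairwise intersections of distinct components. [cite: Chirka1989, §16.1, p. 206] -/
theorem toCurrent_add_of_isRectifiableData (h : Harvey1977_isRectifiableData_toCurrent.{u})
    (T T' : HolomorphicChain 𝓘(ℂ, V) Ω p)
    (hnull : ∀ Z Z' : Set Ω, Z ≠ Z' → (T.mult Z ≠ 0 ∨ T'.mult Z ≠ 0) →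
      (T.mult Z' ≠ 0 ∨ T'.mult Z' ≠ 0) →
        (μHE[2 * p] : Measure V) ((↑) '' (Z ∩ Z') : Set V) = 0) :
    (T + T').toCurrent = T.toCurrent + T'.toCurrent :=
  T.toCurrent_add_of_null_inter T' (h V Ω p T).1 (h V Ω p T').1 (h V Ω p (T + T')).1
    (h V Ω p T).2.2.2.1 (h V Ω p T').2.2.2.1 (h V Ω p (T + T')).2.2.2.1 hnull

end Harvey

end HolomorphicChain

end Literature.Geometry.Kaehler
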